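import Summits.AtomisticToContinuum.Crystallization.Theses.GappedShellCensus
import Literature.Geometry.DiscreteGeometry.ShellCensusTwelve

/-!
# DRAFT (lead, cycle 1) — abstract interface of the census half (not registered, not landed)

The census half factors as  GEOMETRY → `FanData` → COMBINATORICS:
* geometry (tree bricks + landed stubs): for an all-degree-4 gapped twelve-tuple `t`, the radial
  projection `X` has `0 ∈ interior (conv X)` (`stub_originInterior`), its fan-refined hull triangulation
  `fanTriSets X` has 20 triangles, two per side, single-cycle links, node equation `Σ angles = 2π`
  (`card_fanTriSets`, `card_filter_fanTriSets_eq_two`, `fanTriSets_link`, `sum_triAngleAt`); bonds are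
  hull edges (`stub_bondHullEdge`) hence sides of exactly two fan triangles
  (`card_filter_fanTriSets_eq_two_of_mem_hullEdges`); bonded triangles are facets = fan triangles
  (`stub_bondTriangleFacet`, deferred); corner bounds `stub_tCornerMax` / `stub_hCornerMax` (+ Mathlib
  `InnerProductGeometry.angle_le_angle_add_angle` for a quad split by its other diagonal);
  `three_arccos_quarter_add_two_arccos_807_lt_two_pi` (work/ArccosSum.lean, rc 0).
* combinatorics on `FanData` (labels `Fin 12`): the classification — every vertex has ≤ 3 all-bond
  triangles (angle budget), `3T` ⇒ the fourth sector is not a quad sector (budget), then EITHER the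
  verified growth search (13 maps; cf. the tree's unfinished `KissingSearch*` programme) OR the hand
  classification of card `two-matchings-no-census` (β-calculus for (8,6); apex squeeze for pentagon /
  hexagon face vectors; residual mini-cases) + a geometric hexagon/antiprism axiom (OPEN INPUT #3:
  "a bond-sided face with all corners ≥ 134.7° has area ≥ 3.98 sr", or the band/packing argument).
-/

noncomputable section

namespace Summit.AtomisticToContinuum.Crystallization.Cruxes.ShellTrichotomy.Sketch

open Literature.Geometry.DiscreteGeometry Literature.Geometry.DiscreteGeometry.ShellCensus

/-- Abstract fan data of an all-degree-4 gapped twelve-shell (labels `Fin 12`). -/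
structure FanData where
  /-- bond relation (distance ≤ 1.02) -/
  bond : Fin 12 → Fin 12 → Bool
  /-- fan triangles of the radial hull, as label triples -/
  tri : Finset (Finset (Fin 12))
  /-- angle of the fan triangle `t` at the label `v` (`0` if `v ∉ t`) -/
  ang : Finset (Fin 12) → Fin 12 → ℝ
  bond_symm : ∀ v w, bond v w = bond w v
  bond_irrefl : ∀ v, bond v v = false
  bond_four : ∀ v, (Finset.univ.filter fun w => bond v w = true).card = 4
  tri_card : ∀ t ∈ tri, t.card = 3
  card_tri : tri.card = 20
  two_per_side : ∀ t ∈ tri, ∀ s ⊆ t, s.card = 2 → (tri.filter fun t' => s ⊆ t').card = 2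
  bond_side : ∀ v w, bond v w = true → (tri.filter fun t' => ({v, w} : Finset (Fin 12)) ⊆ t').card = 2
  bond_tri : ∀ a b c, a ≠ b → b ≠ c → a ≠ c → bond a b = true → bond b c = true → bond a c = true →
    ({a, b, c} : Finset (Fin 12)) ∈ tri
  link : ∀ v, ∀ A ⊆ tri.filter (fun t => v ∈ t), A.Nonempty →
    (∀ t ∈ A, ∀ t' ∈ tri, v ∈ t' → (t ∩ t').card = 2 → t' ∈ A) → A = tri.filter fun t => v ∈ t
  ang_nonneg : ∀ t v, 0 ≤ ang t v
  ang_pos : ∀ t ∈ tri, ∀ v ∈ t, 0 < ang t v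
  ang_zero : ∀ t v, v ∉ t → ang t v = 0
  sum_ang : ∀ v, ∑ t ∈ tri, ang t v = 2 * Real.pi
  tCorner : ∀ t ∈ tri, (∀ v ∈ t, ∀ w ∈ t, v ≠ w → bond v w = true) → ∀ v ∈ t, ang t v ≤ Real.arccos (1 / 4)
  hCorner : ∀ v a x, ({v, a, x} : Finset (Fin 12)) ∈ tri → bond v a = true → bond a x = true →
    bond v x = false → v ≠ x → ang {v, a, x} v ≤ Real.arccos (807 / 2000)
  qCorner : ∀ v d a x, ({v, d, a} : Finset (Fin 12)) ∈ tri → bond v d = true → bond v a = true →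
    bond d a = false → d ≠ a → bond d x = true → bond x a = true → x ≠ v →
    ang {v, d, a} v ≤ 2 * Real.arccos (807 / 2000)
  /-- OPEN geometric input #3 (hexagon / antiprism kill), provisional combinatorial form -/
  not_all_threeT : ¬ ∀ v, ((tri.filter fun t => v ∈ t).filter
    fun t => ∀ a ∈ t, ∀ b ∈ t, a ≠ b → bond a b = true).card = 3

/-- The conclusion of the census on abstract data: the bond graph is, up to relabelling, the
cuboctahedral or the anticuboctahedral graph. -/
def FanData.Concl (D : FanData) : Prop :=
  ∃ σ : Equiv.Perm (Fin 12),
    (∀ v w, v ≠ w → (D.bond (σ v) (σ w) = true ↔ sqNormInt (fccVec v - fccVec w) = 2)) ∨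
    (∀ v w, v ≠ w → (D.bond (σ v) (σ w) = true ↔ sqNormInt (hcpVec v - hcpVec w) = 18))

end Summit.AtomisticToContinuum.Crystallization.Cruxes.ShellTrichotomy.Sketch

end
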